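import Literature.NumberTheory.EllipticCurves.DivisionTowerH1OrderTwoSurjective
import HarnessLib

/-!
# Route `GenusKolyvaginAtTwo`, residual `OffCutResidualAtTwoR` (stmt-BirchSwinnertonDyer-31767), LINE 27 «socle_selection» STUB S2, conjunct (HL) —
# FRAME DATA for the visibility criterion: the tree's Lawson–Wuthrich discharge lemmas (diagonal family, `LDU`, special matrices) made citable,
# and the element `d` with `ρ(d) = diag(1, −1)` (`t d t⁻¹ ≡ d (t²)⁻¹`, `t' d t'⁻¹ ≡ d (t'²)⁻¹`, `E₁ + E₂ ∉ (d − 1)E[2^k]`)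

Seat `bsd-line-gk2-p4` g30 (cell `bsd-f1-sign2`), WIDTH-5 attach on route `GenusKolyvaginAtTwo` rev 59; part 1 of the elliptic-curve discharge of
`…SocleSelectionRealVisibleCriterion` (part 2 = `…SocleSelectionRealVisibleFrame`).  `--supports stmt-BirchSwinnertonDyer-31767 --as helper`.  THEOREMS
ONLY (no definition, no named fact, no `sorry`); standard axioms.  **BSD is NOT proved by this file; nothing is closed by it.**

In the frame `e : E[2^k] ≃ (ℤ/2^k)²`, `ρ : Γ_K → GL₂(ℤ/2^k)` (`DivisionTowerH1OrderTwoFrames`) of an elliptic `E/K`, ANY field, `k = j + 1 ≥ 1`: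
* §1 the frame data of the tree's order-two discharge — `mem_fixingSubgroup_of_diag`, `conj_diag_t`, `conj_diag_t'`, `mem_closure_of_mem_fixingSubgroup`
  (`LDU`), `exists_gl_T/T'/S/Z` — VERBATIM re-proofs of the `private` lemmas of `DivisionTowerH1OrderTwoSurjective.lean` (Lawson–Wuthrich 2016 §2),
  public here so that part 2 can feed them to the abstract criterion;
* §2 the element `d` with `ρ(d) = diag(1, −1)`: `conj_diagNeg_t` / `conj_diagNeg_t'` (relations with ODD exponent `−1`, from `T D T = D`, `T' D T' = D`)
  and `smul_sub_ne_E₁_add_E₂` (`E₁ + E₂ ∉ (d − 1)E[2^k]`: first coordinate `0 ≠ 2^j`).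
BSD is NOT proved by any of this.

References: [LawsonWuthrich2016] Lemma 3, §2, §7.1; [Sah1968] Prop. 2.7 (b).
-/

set_option autoImplicit false
set_option linter.dupNamespace false -- `Summit.<P>.<Sub>` repeats `BirchSwinnertonDyer` (D-0017)

noncomputable section

open scoped Classical MatrixGroups

namespace Summit.BirchSwinnertonDyer.BirchSwinnertonDyer.Theorems.GenusExact.PlusDescent.SocleSelection.RealVisible

open WeierstrassCurve Field Matrix Literature.NumberTheory.EllipticCurves Literature.NumberTheory.GaloisRepresentations
open Literature.NumberTheory.EllipticCurves.LawsonWuthrich2016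

universe u

/-! ## §1 The frame data (re-proofs of the tree's `private` discharge lemmas, public here) -/

section Discharge

variable {K : Type u} [Field K] (W : WeierstrassCurve K) (j : ℕ)
  (e : geomTorsion W ((2 ^ (j + 1) : ℕ) : ℤ) ≃+ (Fin 2 → ZMod (2 ^ (j + 1))))
  (ρ : absoluteGaloisGroup K →* GL (Fin 2) (ZMod (2 ^ (j + 1))))
  (hρ : ∀ (σ : absoluteGaloisGroup K) (P : geomTorsion W ((2 ^ (j + 1) : ℕ) : ℤ)),
    e (σ • P) = ((ρ σ : GL (Fin 2) (ZMod (2 ^ (j + 1)))) : Matrix (Fin 2) (Fin 2) (ZMod (2 ^ (j + 1)))) *ᵥ e P)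

omit hρ in
/-- The diagonal entries of an invertible diagonal matrix are units. [folklore] -/
theorem isUnit_diag (U : GL (Fin 2) (ZMod (2 ^ (j + 1)))) (h01 : (U : Matrix (Fin 2) (Fin 2) (ZMod (2 ^ (j + 1)))) 0 1 = 0)
    (h10 : (U : Matrix (Fin 2) (Fin 2) (ZMod (2 ^ (j + 1)))) 1 0 = 0) :
    IsUnit ((U : Matrix (Fin 2) (Fin 2) (ZMod (2 ^ (j + 1)))) 0 0) ∧ IsUnit ((U : Matrix (Fin 2) (Fin 2) (ZMod (2 ^ (j + 1)))) 1 1) := by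
  have hdet : IsUnit (U : Matrix (Fin 2) (Fin 2) (ZMod (2 ^ (j + 1)))).det :=
    (Matrix.isUnit_iff_isUnit_det _).1 (Units.isUnit U)
  rw [Matrix.det_fin_two, h01, h10, mul_zero, sub_zero] at hdet
  exact IsUnit.mul_iff.1 hdet

omit hρ in
/-- An invertible diagonal matrix is `diag(U₀₀, U₁₁)`. [folklore] -/
theorem eq_diag (U : GL (Fin 2) (ZMod (2 ^ (j + 1)))) (h01 : (U : Matrix (Fin 2) (Fin 2) (ZMod (2 ^ (j + 1)))) 0 1 = 0)
    (h10 : (U : Matrix (Fin 2) (Fin 2) (ZMod (2 ^ (j + 1)))) 1 0 = 0) :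
    (U : Matrix (Fin 2) (Fin 2) (ZMod (2 ^ (j + 1)))) =
      !![(U : Matrix (Fin 2) (Fin 2) (ZMod (2 ^ (j + 1)))) 0 0, 0; 0, (U : Matrix (Fin 2) (Fin 2) (ZMod (2 ^ (j + 1)))) 1 1] := by
  conv_lhs => rw [Matrix.eta_fin_two (U : Matrix (Fin 2) (Fin 2) (ZMod (2 ^ (j + 1))))]
  rw [h01, h10]

omit hρ in
/-- A unit of `ℤ/2^{j+1}` fixes `2^j`. [folklore] -/
theorem unit_mul_half {a : (ZMod (2 ^ (j + 1)))} (ha : IsUnit a) : a * ((2 : ZMod (2 ^ (j + 1))) ^ j) = ((2 : ZMod (2 ^ (j + 1))) ^ j) := by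
  obtain ⟨u, rfl⟩ := ha
  obtain ⟨c, hc⟩ := exists_unit_eq_one_add_two_mul j u
  rw [hc, one_add_two_mul_mul_half]

include hρ in
/-- A `σ` with diagonal `ρ(σ)` fixes `V = E[2]`. [cite: LawsonWuthrich2016, §2] -/
theorem mem_fixingSubgroup_of_diag {σ : absoluteGaloisGroup K}
    (h01 : ((ρ σ : GL (Fin 2) (ZMod (2 ^ (j + 1)))) : Matrix (Fin 2) (Fin 2) (ZMod (2 ^ (j + 1)))) 0 1 = 0)
    (h10 : ((ρ σ : GL (Fin 2) (ZMod (2 ^ (j + 1)))) : Matrix (Fin 2) (Fin 2) (ZMod (2 ^ (j + 1)))) 1 0 = 0) :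
    σ ∈ fixingSubgroup (absoluteGaloisGroup K)
      {v : geomTorsion W ((2 ^ (j + 1) : ℕ) : ℤ) | (2 : ℤ) • v = 0} := by
  obtain ⟨hu0, hu1⟩ := isUnit_diag j (ρ σ) h01 h10
  refine Rubin1987.mem_fixingSubgroup_of_smul_eq (mem_V_iff W j e) ?_ ?_
  · rw [smul_symm_of_rep_eq W j e ρ hρ (eq_diag j (ρ σ) h01 h10), mulVec_two, unit_mul_half j hu0]
    congr 1; funext i; fin_cases i <;> simp
  · rw [smul_symm_of_rep_eq W j e ρ hρ (eq_diag j (ρ σ) h01 h10), mulVec_two, unit_mul_half j hu1]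
    congr 1; funext i; fin_cases i <;> simp

include hρ in
/-- `t σ t⁻¹ ≡ σ (t²)^m (mod Γ_{K(E[2^k])})` for diagonal `ρ(σ) = diag(x, y)`: `T D = D T^{2m+1}` with `2 m x = y − x`.
[cite: LawsonWuthrich2016, §2] -/
theorem conj_diag_t {σ t : absoluteGaloisGroup K}
    (ht : ((ρ t : GL (Fin 2) (ZMod (2 ^ (j + 1)))) : Matrix (Fin 2) (Fin 2) (ZMod (2 ^ (j + 1)))) = !![1, 1; 0, 1])
    (h01 : ((ρ σ : GL (Fin 2) (ZMod (2 ^ (j + 1)))) : Matrix (Fin 2) (Fin 2) (ZMod (2 ^ (j + 1)))) 0 1 = 0)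
    (h10 : ((ρ σ : GL (Fin 2) (ZMod (2 ^ (j + 1)))) : Matrix (Fin 2) (Fin 2) (ZMod (2 ^ (j + 1)))) 1 0 = 0) :
    ∃ (m : ℤ), ∃ n ∈ torsionFixing W ((2 ^ (j + 1) : ℕ) : ℤ), t * σ * t⁻¹ = σ * (t * t) ^ m * n := by
  haveI : NeZero (2 ^ (j + 1)) := ⟨pow_ne_zero _ two_ne_zero⟩
  obtain ⟨hu0, hu1⟩ := isUnit_diag j (ρ σ) h01 h10
  obtain ⟨u, hu⟩ := hu0
  obtain ⟨v, hv⟩ := hu1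
  obtain ⟨c, hc⟩ := exists_units_sub_eq_two_mul j u v
  set m : ℕ := (c * ((u⁻¹ : (ZMod (2 ^ (j + 1)))ˣ) : (ZMod (2 ^ (j + 1))))).val with hm
  have hmR : (m : (ZMod (2 ^ (j + 1)))) = c * ((u⁻¹ : (ZMod (2 ^ (j + 1)))ˣ) : (ZMod (2 ^ (j + 1)))) := by rw [hm, ZMod.natCast_zmod_val]
  have hy : ((ρ σ : GL (Fin 2) (ZMod (2 ^ (j + 1)))) : Matrix (Fin 2) (Fin 2) (ZMod (2 ^ (j + 1)))) 1 1 =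
      ((ρ σ : GL (Fin 2) (ZMod (2 ^ (j + 1)))) : Matrix (Fin 2) (Fin 2) (ZMod (2 ^ (j + 1)))) 0 0 * (2 * (m : (ZMod (2 ^ (j + 1)))) + 1) := by
    rw [← hu, ← hv, hmR]
    have h1 : (u : (ZMod (2 ^ (j + 1)))) * ((u⁻¹ : (ZMod (2 ^ (j + 1)))ˣ) : (ZMod (2 ^ (j + 1)))) = 1 := Units.mul_inv u
    linear_combination hc - 2 * c * h1
  have key : ρ (t * σ) = ρ (σ * (t * t) ^ m * t) := by
    apply Units.ext
    rw [map_mul, map_mul, map_mul, map_pow, map_mul, Units.val_mul, Units.val_mul, Units.val_mul,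
      Units.val_pow_eq_pow_val, Units.val_mul, ht, eq_diag j (ρ σ) h01 h10,
      transvection_mul_diagonal _ _ (m : (ZMod (2 ^ (j + 1)))) hy, mul_assoc, ← pow_two, ← pow_mul, ← pow_succ,
      transvection_pow]
    congr 2
    push_cast; ring
  have key' : ρ (t * σ * t⁻¹) = ρ (σ * (t * t) ^ m) := by
    rw [map_mul, key, map_mul, map_inv, mul_inv_cancel_right]
  obtain ⟨n, hn, h⟩ := exists_mem_torsionFixing_of_rep_eq W e ρ hρ key'
  exact ⟨m, n, hn, by rw [zpow_natCast]; exact h⟩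

include hρ in
/-- `t' σ t'⁻¹ ≡ σ (t'²)^m (mod Γ_{K(E[2^k])})` for diagonal `ρ(σ)`: `T' D = D T'^{2m+1}` with `2 m y = x − y`. [cite: LawsonWuthrich2016, §2] -/
theorem conj_diag_t' {σ t' : absoluteGaloisGroup K}
    (ht' : ((ρ t' : GL (Fin 2) (ZMod (2 ^ (j + 1)))) : Matrix (Fin 2) (Fin 2) (ZMod (2 ^ (j + 1)))) = !![1, 0; 1, 1])
    (h01 : ((ρ σ : GL (Fin 2) (ZMod (2 ^ (j + 1)))) : Matrix (Fin 2) (Fin 2) (ZMod (2 ^ (j + 1)))) 0 1 = 0)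
    (h10 : ((ρ σ : GL (Fin 2) (ZMod (2 ^ (j + 1)))) : Matrix (Fin 2) (Fin 2) (ZMod (2 ^ (j + 1)))) 1 0 = 0) :
    ∃ (m : ℤ), ∃ n ∈ torsionFixing W ((2 ^ (j + 1) : ℕ) : ℤ),
      t' * σ * t'⁻¹ = σ * (t' * t') ^ m * n := by
  haveI : NeZero (2 ^ (j + 1)) := ⟨pow_ne_zero _ two_ne_zero⟩
  obtain ⟨hu0, hu1⟩ := isUnit_diag j (ρ σ) h01 h10
  obtain ⟨u, hu⟩ := hu0
  obtain ⟨v, hv⟩ := hu1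
  obtain ⟨c, hc⟩ := exists_units_sub_eq_two_mul j u v
  set m : ℕ := (-c * ((v⁻¹ : (ZMod (2 ^ (j + 1)))ˣ) : (ZMod (2 ^ (j + 1))))).val with hm
  have hmR : (m : (ZMod (2 ^ (j + 1)))) = -c * ((v⁻¹ : (ZMod (2 ^ (j + 1)))ˣ) : (ZMod (2 ^ (j + 1)))) := by rw [hm, ZMod.natCast_zmod_val]
  have hx : ((ρ σ : GL (Fin 2) (ZMod (2 ^ (j + 1)))) : Matrix (Fin 2) (Fin 2) (ZMod (2 ^ (j + 1)))) 0 0 =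
      ((ρ σ : GL (Fin 2) (ZMod (2 ^ (j + 1)))) : Matrix (Fin 2) (Fin 2) (ZMod (2 ^ (j + 1)))) 1 1 * (2 * (m : (ZMod (2 ^ (j + 1)))) + 1) := by
    rw [← hu, ← hv, hmR]
    have h1 : (v : (ZMod (2 ^ (j + 1)))) * ((v⁻¹ : (ZMod (2 ^ (j + 1)))ˣ) : (ZMod (2 ^ (j + 1)))) = 1 := Units.mul_inv v
    linear_combination -hc + 2 * c * h1
  have key : ρ (t' * σ) = ρ (σ * (t' * t') ^ m * t') := by
    apply Units.ext
    rw [map_mul, map_mul, map_mul, map_pow, map_mul, Units.val_mul, Units.val_mul, Units.val_mul,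
      Units.val_pow_eq_pow_val, Units.val_mul, ht', eq_diag j (ρ σ) h01 h10,
      transvection'_mul_diagonal _ _ (m : (ZMod (2 ^ (j + 1)))) hx, mul_assoc, ← pow_two, ← pow_mul, ← pow_succ,
      transvection'_pow]
    congr 2
    push_cast; ring
  have key' : ρ (t' * σ * t'⁻¹) = ρ (σ * (t' * t') ^ m) := by
    rw [map_mul, key, map_mul, map_inv, mul_inv_cancel_right]
  obtain ⟨n, hn, h⟩ := exists_mem_torsionFixing_of_rep_eq W e ρ hρ key'
  exact ⟨m, n, hn, by rw [zpow_natCast]; exact h⟩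

include hρ in
/-- The matrix of a `σ ∈ G_V` is `≡ 1 (mod 2)`. [cite: LawsonWuthrich2016, §2] -/
theorem entries_of_mem_fixingSubgroup {σ : absoluteGaloisGroup K}
    (hσ : σ ∈ fixingSubgroup (absoluteGaloisGroup K)
      {v : geomTorsion W ((2 ^ (j + 1) : ℕ) : ℤ) | (2 : ℤ) • v = 0}) :
    ((ρ σ : GL (Fin 2) (ZMod (2 ^ (j + 1)))) : Matrix (Fin 2) (Fin 2) (ZMod (2 ^ (j + 1)))) 0 0 * ((2 : ZMod (2 ^ (j + 1))) ^ j) = ((2 : ZMod (2 ^ (j + 1))) ^ j) ∧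
      ((ρ σ : GL (Fin 2) (ZMod (2 ^ (j + 1)))) : Matrix (Fin 2) (Fin 2) (ZMod (2 ^ (j + 1)))) 0 1 * ((2 : ZMod (2 ^ (j + 1))) ^ j) = 0 ∧
      ((ρ σ : GL (Fin 2) (ZMod (2 ^ (j + 1)))) : Matrix (Fin 2) (Fin 2) (ZMod (2 ^ (j + 1)))) 1 0 * ((2 : ZMod (2 ^ (j + 1))) ^ j) = 0 ∧
      ((ρ σ : GL (Fin 2) (ZMod (2 ^ (j + 1)))) : Matrix (Fin 2) (Fin 2) (ZMod (2 ^ (j + 1)))) 1 1 * ((2 : ZMod (2 ^ (j + 1))) ^ j) = ((2 : ZMod (2 ^ (j + 1))) ^ j) := by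
  have h1 := (mem_fixingSubgroup_iff _).1 hσ (e.symm ![((2 : ZMod (2 ^ (j + 1))) ^ j), 0]) (two_zsmul_E₁ W j e)
  have h2 := (mem_fixingSubgroup_iff _).1 hσ (e.symm ![0, ((2 : ZMod (2 ^ (j + 1))) ^ j)]) (two_zsmul_E₂ W j e)
  rw [smul_symm_of_rep_eq W j e ρ hρ (Matrix.eta_fin_two _), mulVec_two] at h1 h2
  have h1' := congr_fun (e.symm.injective h1)
  have h2' := congr_fun (e.symm.injective h2)
  have a := h1' 0; have c := h1' 1; have b := h2' 0; have d := h2' 1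
  simp only [mul_zero, add_zero, zero_add, Matrix.cons_val_zero, Matrix.cons_val_one,
    Matrix.cons_val_fin_one] at a b c d
  exact ⟨a, b, c, d⟩

include hρ in
/-- `G_V ⊆ ⟨t², t'², diagonal⟩` (`LDU`). [cite: LawsonWuthrich2016, §2] -/
theorem mem_closure_of_mem_fixingSubgroup {t t' : absoluteGaloisGroup K}
    (ht : ((ρ t : GL (Fin 2) (ZMod (2 ^ (j + 1)))) : Matrix (Fin 2) (Fin 2) (ZMod (2 ^ (j + 1)))) = !![1, 1; 0, 1])
    (ht' : ((ρ t' : GL (Fin 2) (ZMod (2 ^ (j + 1)))) : Matrix (Fin 2) (Fin 2) (ZMod (2 ^ (j + 1)))) = !![1, 0; 1, 1])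
    {σ : absoluteGaloisGroup K}
    (hσ : σ ∈ fixingSubgroup (absoluteGaloisGroup K)
      {v : geomTorsion W ((2 ^ (j + 1) : ℕ) : ℤ) | (2 : ℤ) • v = 0}) :
    σ ∈ Subgroup.closure ({t * t, t' * t'} ∪ Set.range (fun δ : {δ : absoluteGaloisGroup K //
      ((ρ δ : GL (Fin 2) (ZMod (2 ^ (j + 1)))) : Matrix (Fin 2) (Fin 2) (ZMod (2 ^ (j + 1)))) 0 1 = 0 ∧
      ((ρ δ : GL (Fin 2) (ZMod (2 ^ (j + 1)))) : Matrix (Fin 2) (Fin 2) (ZMod (2 ^ (j + 1)))) 1 0 = 0} ↦ (δ : absoluteGaloisGroup K))) := by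
  haveI : NeZero (2 ^ (j + 1)) := ⟨pow_ne_zero _ two_ne_zero⟩
  obtain ⟨ha, hb, hc, -⟩ := entries_of_mem_fixingSubgroup W j e ρ hρ hσ
  set A : Matrix (Fin 2) (Fin 2) (ZMod (2 ^ (j + 1))) := ((ρ σ : GL (Fin 2) (ZMod (2 ^ (j + 1)))) : Matrix (Fin 2) (Fin 2) (ZMod (2 ^ (j + 1)))) with hA
  obtain ⟨a₁, ha₁⟩ := exists_eq_two_mul_of_mul_half_eq_zero j (A 0 0 - 1)
    (by rw [sub_mul, one_mul, ha, sub_self])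
  have hαu : IsUnit (A 0 0) := by
    rw [show A 0 0 = 1 + 2 * a₁ by rw [← ha₁]; ring]; exact isUnit_one_add_two_mul j a₁
  obtain ⟨u, hu⟩ := hαu
  obtain ⟨β', hβ'⟩ := exists_eq_two_mul_of_mul_half_eq_zero j _ hb
  obtain ⟨γ', hγ'⟩ := exists_eq_two_mul_of_mul_half_eq_zero j _ hc
  set na : ℕ := (-(γ' * ((u⁻¹ : (ZMod (2 ^ (j + 1)))ˣ) : (ZMod (2 ^ (j + 1)))))).val with hna
  set nb : ℕ := (-(((u⁻¹ : (ZMod (2 ^ (j + 1)))ˣ) : (ZMod (2 ^ (j + 1)))) * β')).val with hnb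
  have hnaR : (na : (ZMod (2 ^ (j + 1)))) = -(γ' * ((u⁻¹ : (ZMod (2 ^ (j + 1)))ˣ) : (ZMod (2 ^ (j + 1))))) := by rw [hna, ZMod.natCast_zmod_val]
  have hnbR : (nb : (ZMod (2 ^ (j + 1)))) = -(((u⁻¹ : (ZMod (2 ^ (j + 1)))ˣ) : (ZMod (2 ^ (j + 1)))) * β') := by rw [hnb, ZMod.natCast_zmod_val]
  have h1 : (u : (ZMod (2 ^ (j + 1)))) * ((u⁻¹ : (ZMod (2 ^ (j + 1)))ˣ) : (ZMod (2 ^ (j + 1)))) = 1 := Units.mul_inv u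
  have hbrel : A 0 0 * (2 * (nb : (ZMod (2 ^ (j + 1))))) + A 0 1 = 0 := by
    rw [hnbR, hβ', ← hu]; linear_combination (-(2 : (ZMod (2 ^ (j + 1)))) * β') * h1
  have harel : 2 * (na : (ZMod (2 ^ (j + 1)))) * A 0 0 + A 1 0 = 0 := by
    rw [hnaR, hγ', ← hu]; linear_combination (-(2 : (ZMod (2 ^ (j + 1)))) * γ') * h1
  set δ₀ : absoluteGaloisGroup K := (t' * t') ^ na * σ * (t * t) ^ nb with hδ₀
  have hδ₀mat : ((ρ δ₀ : GL (Fin 2) (ZMod (2 ^ (j + 1)))) : Matrix (Fin 2) (Fin 2) (ZMod (2 ^ (j + 1)))) =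
      !![A 0 0, 0; 0, 2 * (na : (ZMod (2 ^ (j + 1)))) * A 0 1 + A 1 1] := by
    rw [hδ₀, map_mul, map_mul, map_pow, map_pow, map_mul, map_mul, Units.val_mul, Units.val_mul,
      Units.val_pow_eq_pow_val, Units.val_pow_eq_pow_val, Units.val_mul, Units.val_mul, ht, ht',
      ← pow_two, ← pow_two, ← pow_mul, ← pow_mul, transvection_pow, transvection'_pow, ← hA]
    push_cast
    conv_lhs => rw [Matrix.eta_fin_two A]
    rw [lower_mul_mul_upper_eq_diagonal _ _ _ _ _ _ hbrel harel]
  set S : Set (absoluteGaloisGroup K) := ({t * t, t' * t'} ∪ Set.range (fun δ : {δ : absoluteGaloisGroup K //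
      ((ρ δ : GL (Fin 2) (ZMod (2 ^ (j + 1)))) : Matrix (Fin 2) (Fin 2) (ZMod (2 ^ (j + 1)))) 0 1 = 0 ∧
      ((ρ δ : GL (Fin 2) (ZMod (2 ^ (j + 1)))) : Matrix (Fin 2) (Fin 2) (ZMod (2 ^ (j + 1)))) 1 0 = 0} ↦ (δ : absoluteGaloisGroup K)))
    with hSdef
  have hδ₀S : δ₀ ∈ S := by
    refine Set.mem_union_right _ ⟨⟨δ₀, ?_, ?_⟩, rfl⟩
    · rw [hδ₀mat]; simp
    · rw [hδ₀mat]; simp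
  have htt : t * t ∈ Subgroup.closure S :=
    Subgroup.subset_closure (Set.mem_union_left _ (Set.mem_insert _ _))
  have ht't' : t' * t' ∈ Subgroup.closure S :=
    Subgroup.subset_closure (Set.mem_union_left _ (Set.mem_insert_of_mem _ (Set.mem_singleton _)))
  have hδ₀' : δ₀ ∈ Subgroup.closure S := Subgroup.subset_closure hδ₀S
  have hσ_eq : σ = ((t' * t') ^ na)⁻¹ * δ₀ * ((t * t) ^ nb)⁻¹ := by rw [hδ₀]; group
  rw [hσ_eq]
  exact (Subgroup.closure S).mul_mem ((Subgroup.closure S).mul_mem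
    ((Subgroup.closure S).inv_mem ((Subgroup.closure S).pow_mem ht't' na)) hδ₀')
    ((Subgroup.closure S).inv_mem ((Subgroup.closure S).pow_mem htt nb))

omit hρ in
/-- A matrix with a two-sided inverse is the value of an element of `GL₂`. [folklore] -/
theorem exists_gl (A B : Matrix (Fin 2) (Fin 2) (ZMod (2 ^ (j + 1)))) (h1 : A * B = 1) (h2 : B * A = 1) :
    ∃ U : GL (Fin 2) (ZMod (2 ^ (j + 1))), (U : Matrix (Fin 2) (Fin 2) (ZMod (2 ^ (j + 1)))) = A :=
  ⟨⟨A, B, h1, h2⟩, rfl⟩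

omit hρ in
/-- The transvection `(1 1; 0 1)` lies in `GL₂(ℤ/2^k)`. [folklore] -/
theorem exists_gl_T : ∃ U : GL (Fin 2) (ZMod (2 ^ (j + 1))), (U : Matrix (Fin 2) (Fin 2) (ZMod (2 ^ (j + 1)))) = !![1, 1; 0, 1] :=
  exists_gl j _ !![1, -1; 0, 1]
    (by ext i k; fin_cases i <;> fin_cases k <;> simp [Matrix.mul_apply, Fin.sum_univ_two])
    (by ext i k; fin_cases i <;> fin_cases k <;> simp [Matrix.mul_apply, Fin.sum_univ_two])

omit hρ in
/-- The transvection `(1 0; 1 1)` lies in `GL₂(ℤ/2^k)`. [folklore] -/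
theorem exists_gl_T' : ∃ U : GL (Fin 2) (ZMod (2 ^ (j + 1))), (U : Matrix (Fin 2) (Fin 2) (ZMod (2 ^ (j + 1)))) = !![1, 0; 1, 1] :=
  exists_gl j _ !![1, 0; -1, 1]
    (by ext i k; fin_cases i <;> fin_cases k <;> simp [Matrix.mul_apply, Fin.sum_univ_two])
    (by ext i k; fin_cases i <;> fin_cases k <;> simp [Matrix.mul_apply, Fin.sum_univ_two])

omit hρ in
/-- The swap `(0 1; 1 0)` lies in `GL₂(ℤ/2^k)`. [folklore] -/
theorem exists_gl_S : ∃ U : GL (Fin 2) (ZMod (2 ^ (j + 1))), (U : Matrix (Fin 2) (Fin 2) (ZMod (2 ^ (j + 1)))) = !![0, 1; 1, 0] :=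
  exists_gl j _ !![0, 1; 1, 0]
    (by ext i k; fin_cases i <;> fin_cases k <;> simp [Matrix.mul_apply, Fin.sum_univ_two])
    (by ext i k; fin_cases i <;> fin_cases k <;> simp [Matrix.mul_apply, Fin.sum_univ_two])

omit hρ in
/-- The homothety `3` lies in `GL₂(ℤ/2^k)`. [folklore] -/
theorem exists_gl_Z : ∃ U : GL (Fin 2) (ZMod (2 ^ (j + 1))), (U : Matrix (Fin 2) (Fin 2) (ZMod (2 ^ (j + 1)))) = !![3, 0; 0, 3] := by
  obtain ⟨w, hw⟩ := isUnit_one_add_two_mul j (1 : (ZMod (2 ^ (j + 1))))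
  have h3 : (w : (ZMod (2 ^ (j + 1)))) = 3 := by rw [hw]; norm_num
  have hinv : (3 : (ZMod (2 ^ (j + 1)))) * ((w⁻¹ : (ZMod (2 ^ (j + 1)))ˣ) : (ZMod (2 ^ (j + 1)))) = 1 := by rw [← h3, Units.mul_inv]
  have hinv' : ((w⁻¹ : (ZMod (2 ^ (j + 1)))ˣ) : (ZMod (2 ^ (j + 1)))) * 3 = 1 := by rw [← h3, Units.inv_mul]
  exact exists_gl j _ !![((w⁻¹ : (ZMod (2 ^ (j + 1)))ˣ) : (ZMod (2 ^ (j + 1)))), 0; 0, ((w⁻¹ : (ZMod (2 ^ (j + 1)))ˣ) : (ZMod (2 ^ (j + 1))))]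
    (by ext i k; fin_cases i <;> fin_cases k <;> simp [Matrix.mul_apply, Fin.sum_univ_two, hinv])
    (by ext i k; fin_cases i <;> fin_cases k <;> simp [Matrix.mul_apply, Fin.sum_univ_two, hinv'])

/-! ## §2 The element `d` with `ρ(d) = diag(1, −1)` -/

include hρ in
/-- **`t d t⁻¹ ≡ d (t²)⁻¹ (mod Γ_{K(E[2^k])})`** for `ρ(d) = diag(1, −1)` (`T D T = D`): the exponent `−1` is ODD. [cite: LawsonWuthrich2016, §2] -/
theorem conj_diagNeg_t {d t : absoluteGaloisGroup K}
    (ht : ((ρ t : GL (Fin 2) (ZMod (2 ^ (j + 1)))) : Matrix (Fin 2) (Fin 2) (ZMod (2 ^ (j + 1)))) = !![1, 1; 0, 1])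
    (hd : ((ρ d : GL (Fin 2) (ZMod (2 ^ (j + 1)))) : Matrix (Fin 2) (Fin 2) (ZMod (2 ^ (j + 1)))) = !![1, 0; 0, -1]) :
    ∃ m : ℤ, Odd m ∧ ∃ n ∈ torsionFixing W ((2 ^ (j + 1) : ℕ) : ℤ), t * d * t⁻¹ = d * (t * t) ^ m * n := by
  have key : ρ (t * d * t) = ρ d := by
    apply Units.ext
    rw [map_mul, map_mul, Units.val_mul, Units.val_mul, ht, hd]
    ext i k; fin_cases i <;> fin_cases k <;> simp [Matrix.mul_apply, Fin.sum_univ_two]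
  obtain ⟨n₀, hn₀, hrel⟩ := exists_mem_torsionFixing_of_rep_eq W e ρ hρ key
  refine ⟨-1, ⟨-1, by norm_num⟩, (t * t) * n₀ * (t * t)⁻¹, Subgroup.Normal.conj_mem inferInstance n₀ hn₀ (t * t), ?_⟩
  have h1 : t * d * t⁻¹ = (t * d * t) * t⁻¹ * t⁻¹ := by group
  rw [h1, hrel, _root_.zpow_neg_one]
  group

include hρ in
/-- **`t' d t'⁻¹ ≡ d (t'²)⁻¹ (mod Γ_{K(E[2^k])})`** for `ρ(d) = diag(1, −1)` (`T' D T' = D`). [cite: LawsonWuthrich2016, §2] -/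
theorem conj_diagNeg_t' {d t' : absoluteGaloisGroup K}
    (ht' : ((ρ t' : GL (Fin 2) (ZMod (2 ^ (j + 1)))) : Matrix (Fin 2) (Fin 2) (ZMod (2 ^ (j + 1)))) = !![1, 0; 1, 1])
    (hd : ((ρ d : GL (Fin 2) (ZMod (2 ^ (j + 1)))) : Matrix (Fin 2) (Fin 2) (ZMod (2 ^ (j + 1)))) = !![1, 0; 0, -1]) :
    ∃ m : ℤ, Odd m ∧ ∃ n ∈ torsionFixing W ((2 ^ (j + 1) : ℕ) : ℤ), t' * d * t'⁻¹ = d * (t' * t') ^ m * n := by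
  have key : ρ (t' * d * t') = ρ d := by
    apply Units.ext
    rw [map_mul, map_mul, Units.val_mul, Units.val_mul, ht', hd]
    ext i k; fin_cases i <;> fin_cases k <;> simp [Matrix.mul_apply, Fin.sum_univ_two]
  obtain ⟨n₀, hn₀, hrel⟩ := exists_mem_torsionFixing_of_rep_eq W e ρ hρ key
  refine ⟨-1, ⟨-1, by norm_num⟩, (t' * t') * n₀ * (t' * t')⁻¹, Subgroup.Normal.conj_mem inferInstance n₀ hn₀ (t' * t'), ?_⟩
  have h1 : t' * d * t'⁻¹ = (t' * d * t') * t'⁻¹ * t'⁻¹ := by group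
  rw [h1, hrel, _root_.zpow_neg_one]
  group

include hρ in
/-- **`E₁ + E₂ ∉ (d − 1)E[2^k]`** for `ρ(d) = diag(1, −1)`: the first coordinate of `d • y − y` is `0`, that of `E₁ + E₂` is `2^j ≠ 0`.
[cite: LawsonWuthrich2016, §7.1] -/
theorem smul_sub_ne_E₁_add_E₂ {d : absoluteGaloisGroup K}
    (hd : ((ρ d : GL (Fin 2) (ZMod (2 ^ (j + 1)))) : Matrix (Fin 2) (Fin 2) (ZMod (2 ^ (j + 1)))) = !![1, 0; 0, -1])
    (y : geomTorsion W ((2 ^ (j + 1) : ℕ) : ℤ)) :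
    d • y - y ≠ e.symm ![((2 : ZMod (2 ^ (j + 1))) ^ j), 0] + e.symm ![0, ((2 : ZMod (2 ^ (j + 1))) ^ j)] := by
  intro h
  have hy : e (d • y) = (!![1, 0; 0, -1] : Matrix (Fin 2) (Fin 2) (ZMod (2 ^ (j + 1)))) *ᵥ e y := by rw [hρ, hd]
  have h0 : e (d • y - y) 0 = 0 := by
    rw [map_sub, Pi.sub_apply, hy]
    simp [Matrix.mulVec, dotProduct, Fin.sum_univ_two]
  have h2 : e (e.symm ![((2 : ZMod (2 ^ (j + 1))) ^ j), 0] + e.symm ![0, ((2 : ZMod (2 ^ (j + 1))) ^ j)]) 0 =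
      (2 : ZMod (2 ^ (j + 1))) ^ j := by
    rw [map_add, e.apply_symm_apply, e.apply_symm_apply, Pi.add_apply]
    simp
  rw [h, h2] at h0
  exact half_ne_zero j h0

end Discharge

end Summit.BirchSwinnertonDyer.BirchSwinnertonDyer.Theorems.GenusExact.PlusDescent.SocleSelection.RealVisible

end
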